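import Summits.HodgeConjecture.CorCM.MultiFieldWeilDodecicHyperbolic
import Summits.HodgeConjecture.CorCM.MultiFieldWeilUnitsRankedSeparated
import HarnessLib

/-!
# MULTI-FIELD WEIL ENGINE — UP TO TWO NON-ISOGENOUS HYPERBOLIC `(3,3)`-SIXFOLDS over each of several DODECIC CM fields through `k` (sextic part `2`-transitive and
# `3`-homogeneous), times `E` — the Hodge conjecture for every product of copies, given Markman's hyperbolic-sixfold theorem and the displayed hyperbolicity data

Cell `pub-hodgecm2` (COR-CM), seat b30 gen 43 (2026-08-26); count-neutral own lane MULTI-FIELD WEIL ENGINE (stem `MultiFieldWeil*`), `CorCM/MultiFieldWeilDodecicHyperbolic.lean` (F11: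
ONE sixfold per field) with up to TWO non-isogenous sixfolds per field: a unit with two slots is SEPARATED by U1 (`unit_separated_of_twoTransitive`: the image is `2`-transitive by the
degree-`60` pair, and two `3`-subsets of the six `τ`-embeddings that are neither equal nor complementary — Shimura's isogeny criterion applied to non-isogenous structures — have
`ℚ`-independent centred indicators).  Slots: the `τ`-part of the type is a `3`-subset of the SIX `τ`-embeddings of a dodecic field `K ⊇ k` (`n = 6`, `p = 3`, `c = 0`, `w = 3`).  The Weil-space input is `CorCM/MultiFieldWeilMarkmanHyperbolic.lean` (F10: Markman's theorem needs the pair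
`(B, ι(i δ))` HYPERBOLIC — an honest, displayed datum per sixfold); the engine is E4's `hodgeConjectureFor_biproduct_comp_of_unitsSeparated_frames` with one structure per field
(no unit with two slots), the single-slot menu entered through its HOMOGENEOUS alternative (`3`-homogeneity of `Aut(ℂ/k)` on the `τ`-embeddings), and the cross-field movers by
`2`-transitivity (a degree-`60` pair) plus a `τ`-embedding value outside the closure of every other field.  Theorems only; no definition, no named fact, no `sorry`.  HONEST FRAMING:
conditional on the displayed Markman binder `hM6` AND on the displayed hyperbolicity data `hhyp`; `HC_CM` is NOT proved and not asserted.

**`hodgeConjectureFor_biproduct_comp_of_dodecicHyperbolicPairs`.**  `k = Kf i₀` imaginary quadratic with `τ`, `δ ∈ 𝓞_k` with `δ² = −d` (`d ≥ 1`) and `τ(δ) = i√d`; `E = A 0 ⊨ (k; {τ})`;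
slots `B_m = A (m+1) ⊨ (K_{is m}; Φ (m+1))` over DODECIC CM fields `K_i ⊇ iK i (k)` with EXACTLY THREE type members over `τ`, at most TWO slots per field, pairwise NON-ISOGENOUS; for every field: two
`τ`-embeddings `s₀ ≠ t₀` with `[ℚ(τk, s₀K, t₀K) : ℚ] = 60` (`2`-transitive sextic part), `3`-HOMOGENEITY (any three `τ`-embeddings are carried into any three by an automorphism
of `ℂ` over `τ(k)`; e.g. sextic part `𝔖₆`, `𝔄₆`, `PGL₂(5)`), and a `τ`-embedding value outside the Galois closure of every OTHER field; for every slot a HYPERBOLICITY DATUM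
(a projective embedding of the one-slot part `⨁_{Fin 1} B_m` and a non-zero rational hyperplane class for which `(⨁_{Fin 1} B_m, ι(i_m δ))` is hyperbolic).  THEN the Hodge conjecture
holds for EVERY product of copies `⨁_j A(κ j)` (+ dominated form), GIVEN Markman's hyperbolic-sixfold theorem.  By the rank bound (`CorCM/MultiFieldWeilCommutantRankBound.lean`) at most `5`
sixfolds per field could ever be separated; two is what U1's two-set lemma gives here (three or more: successor, via the independence criterion `hli3` of D8).
[cite: Markman2025SecantWeil, Thm 1.5.1 and §1.1] [cite: vanGeemen1994HodgeAV, 4.9, Lemma 5.2 (1) and 5.4] [cite: Deligne1982HodgeCycles, proof of Thm. 4.8 with Prop. 4.4; §5 (b)]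
[cite: Shimura1998, §18.2 Lemma (i)] [cite: Pohlmann1968, Thm 1] [cite: MoonenZarhin1995Duke, Thm. 2.4] [cite: DixonMortimer1996, §1.4 Ex. 1.4.1–1.4.2; §2.1; §9.4]
[cite: Lang2002, VI §1 Thm. 1.1; XIII §4] [cite: MumfordAV1970, §19]

## References
* [Markman2025SecantWeil] E. Markman, arXiv:2502.03415, Thm 1.5.1, §1.1 (unrefereed).  [vanGeemen1994HodgeAV] B. van Geemen, LNM 1594 (1994), 4.9, Lemma 5.2, 5.4.
  [Deligne1982HodgeCycles] P. Deligne, LNM 900 (1982), §4–§5.  [Shimura1998] G. Shimura, *Abelian varieties with complex multiplication and modular functions*, §18.2.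
  [Pohlmann1968] H. Pohlmann, Ann. of Math. 88 (1968), Thm 1.  [MoonenZarhin1995Duke] B. Moonen, Yu. Zarhin, Duke Math. J. 77 (1995), Thm. 2.4.  [DixonMortimer1996] J. D. Dixon,
  B. Mortimer, *Permutation Groups*, GTM 163, §1.4, §2.1, §9.4 (homogeneous groups).  [Lang2002] S. Lang, *Algebra*, GTM 211.  [MumfordAV1970] D. Mumford, *Abelian Varieties*, §19.
-/

noncomputable section

open CategoryTheory CategoryTheory.Limits NumberField IntermediateField

namespace Summit.HodgeConjecture.CorCM.MultiFieldWeil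

open Finset
open Literature.AlgebraicGeometry Literature.AlgebraicGeometry.Motives Literature.AlgebraicGeometry.HodgeTheory
open Literature.AlgebraicGeometry.ComplexMultiplication (IsCMTypeRealisation)
open Literature.AlgebraicTopology.SingularHomology
open Literature.NumberTheory.ComplexMultiplication
open Summit.HodgeConjecture.CorCM.Census.MultiFieldWeil

open scoped Classical

section DodecicPairs

variable {I : Type} {r : ℕ} {Kf : I → Type} [∀ i, Field (Kf i)] [∀ i, NumberField (Kf i)] [∀ i, IsCMField (Kf i)]
  {i₀ : I} {is : Fin r → I} {τ : Kf i₀ →+* ℂ}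
  {A : Fin (r + 1) → AbelianVariety ℂ} {Φ : ∀ j : Fin (r + 1), CMType (Kf (mfSlots i₀ is j))}
  {ι : ∀ j, 𝓞 (Kf (mfSlots i₀ is j)) →+* End (A j)}
  {θ : ∀ j, Kf (mfSlots i₀ is j) →+* Module.End ℂ (complexBetti (A j).X 1)}

/-- **UP TO TWO NON-ISOGENOUS HYPERBOLIC `(3,3)`-SIXFOLDS OVER EACH OF SEVERAL DODECIC CM FIELDS THROUGH `k`, TIMES THE CM CURVE — GIVEN MARKMAN'S HYPERBOLIC-SIXFOLD THEOREM AND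
THE HYPERBOLICITY DATA.**  See the module docstring.  `HC_CM` is NOT asserted. [cite: Markman2025SecantWeil, Thm 1.5.1 and §1.1] [cite: vanGeemen1994HodgeAV, 4.9, Lemma 5.2 (1) and 5.4]
[cite: Shimura1998, §6.1 Corollary of Theorem 2, §18.2 Lemma (i)] [cite: DixonMortimer1996, §1.4 Ex. 1.4.1–1.4.2; §2.1; §9.4] [cite: Lang2002, VI §1 Thm. 1.1; XIII §4] -/
theorem hodgeConjectureFor_biproduct_comp_of_dodecicHyperbolicPairs (hM6 : Markman2025_weilClasses_algebraic_hyperbolicSixfold)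
    {N : ℕ} (κ : Fin N → Fin (r + 1)) (h2 : Module.finrank ℚ (Kf i₀) = 2)
    (hdeg : ∀ m : Fin r, Module.finrank ℚ (Kf (is m)) = 12) (iK : ∀ i : I, Kf i₀ →+* Kf i)
    (hA : ∀ j, IsCMTypeRealisation (Φ j) (A j) (ι j) (θ j)) (hΨ : ∀ σ : Kf i₀ →+* ℂ, σ ∈ (Φ 0).1 ↔ σ = τ)
    (δ : 𝓞 (Kf i₀)) (d : ℕ) (hd : 0 < d) (hδ : ((δ : Kf i₀)) ^ 2 = -(d : Kf i₀)) (hτ : τ (δ : Kf i₀) = Complex.I * (Real.sqrt d : ℂ))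
    (h33 : ∀ m : Fin r, (Finset.univ.filter fun s : Kf (is m) →+* ℂ => s.comp (iK (is m)) = τ ∧ s ∈ (Φ m.succ).1).card = 3)
    (hfib : ∀ m : Fin r, (Finset.univ.filter fun m' : Fin r => is m' = is m).card ≤ 2)
    (hni : ∀ m m' : Fin r, m' ≠ m → is m' = is m → ¬ AbelianVariety.IsIsogenous (A m.succ) (A m'.succ))
    (h60 : ∀ m : Fin r, ∃ s₀ t₀ : Kf (is m) →+* ℂ, s₀.comp (iK (is m)) = τ ∧ t₀.comp (iK (is m)) = τ ∧ s₀ ≠ t₀ ∧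
      Module.finrank ℚ ↥(adjoin ℚ (Set.range τ) ⊔ adjoin ℚ (Set.range s₀ ∪ Set.range t₀)) = 60)
    (h3T : ∀ (m : Fin r) (S S' : Finset (Kf (is m) →+* ℂ)), (∀ s ∈ S, s.comp (iK (is m)) = τ) → (∀ s ∈ S', s.comp (iK (is m)) = τ) → S.card = 3 → S'.card = 3 →
      ∃ ρ : ℂ ≃+* ℂ, (ρ : ℂ →+* ℂ).comp τ = τ ∧ ∀ s ∈ S, (ρ : ℂ →+* ℂ).comp s ∈ S')
    (hout : ∀ m₀ m : Fin r, is m ≠ is m₀ → ∃ s : Kf (is m) →+* ℂ, s.comp (iK (is m)) = τ ∧ ∃ x, s x ∉ normalClosure ℚ (Kf (is m₀)) ℂ)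
    (hhyp : ∀ m : Fin r, ∃ (eP : ProjectiveEmbedding (⨁ fun j : Fin 1 => A (partSlots 0 m j)).X) (a : complexBetti (projectiveSpace eP.n ℂ) 2),
      IsRationalClass a ∧ a ≠ 0 ∧ IsHyperbolicWeilType (⨁ fun j : Fin 1 => A (partSlots 0 m j))
        (biproduct.map fun j : Fin 1 => ι (partSlots 0 m j) (δfam (fun m => iK (is m)) δ (partSlots 0 m j))) 3
        ((d : ℂ) • complexBetti.map eP.ι 2 a +
          complexBetti.map (biproduct.map fun j : Fin 1 => ι (partSlots 0 m j) (δfam (fun m => iK (is m)) δ (partSlots 0 m j))).hom.hom.hom 2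
            (complexBetti.map eP.ι 2 a))) :
    HodgeConjectureFor (⨁ fun j => A (κ j)).dim (⨁ fun j => A (κ j)).X := by
  have hττ : ComplexEmbedding.conjugate τ ≠ τ := QuarticCM.conjugate_ne τ
  have hk : ∀ σ : Kf i₀ →+* ℂ, σ = τ ∨ σ = ComplexEmbedding.conjugate τ := fun σ => QuarticCM.eq_or_eq_conjugate_of_quadratic h2 τ σ
  let im : ∀ m : Fin r, Kf i₀ →+* Kf (is m) := fun m => iK (is m)
  have hdeg' : ∀ m : Fin r, Module.finrank ℚ (Kf (is m)) = 2 * 6 := fun m => by rw [hdeg m]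
  -- (1) the units (all singletons) and ONE SIGN FRAME PER INDEX
  obtain ⟨U, hU⟩ := exists_unitRep is
  have hfr : ∀ i : I, Module.finrank ℚ (Kf i) = 2 * 6 → ∃ E : (Kf i →+* ℂ) ≃ Fin 6 × Bool,
      (∀ s, (E s).2 = true ↔ s.comp (iK i) = τ) ∧ ∀ s, E (ComplexEmbedding.conjugate s) = ((E s).1, !(E s).2) := fun i hdi => exists_signFrame hdi h2 (iK i) hττ hk
  choose E hE_sign hE_conj using hfr
  have diagT : ∀ i j : I, ∀ h : i = j, ∀ (hi : Module.finrank ℚ (Kf i) = 2 * 6) (hj : Module.finrank ℚ (Kf j) = 2 * 6) (ρ : ℂ →+* ℂ) (a x y : Fin 6),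
      ρ.comp ((E i hi).symm (a, true)) = (E i hi).symm (x, true) → ρ.comp ((E j hj).symm (a, true)) = (E j hj).symm (y, true) → x = y := by
    intro i j h; subst h; intro hi hj ρ a x y h₁ h₂
    exact congrArg Prod.fst ((E i hi).symm.injective (h₁.symm.trans h₂))
  -- (2) the frames of the slots, their readings and position sets (all of size `6`)
  let e : ∀ m : Fin r, (Kf (is m) →+* ℂ) ≃ Fin 6 × Bool := fun m => E (is m) (hdeg' m)
  have he_sign : ∀ (m : Fin r) (s : Kf (is m) →+* ℂ), (e m s).2 = true ↔ s.comp (im m) = τ := fun m => hE_sign (is m) (hdeg' m)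
  have he_conj : ∀ (m : Fin r) (s : Kf (is m) →+* ℂ), e m (ComplexEmbedding.conjugate s) = ((e m s).1, !(e m s).2) := fun m => hE_conj (is m) (hdeg' m)
  let P : ∀ _ : Fin r, Finset (Fin 6) := fun m => Finset.univ.filter fun a : Fin 6 => (e m).symm (a, true) ∈ (Φ m.succ).1
  have hΦ : ∀ (m : Fin r) (s : Kf (is m) →+* ℂ), s ∈ (Φ m.succ).1 ↔ (e m s).2 = decide ((e m s).1 ∈ P m) := fun m s =>
    mem_iff_snd_eq_decide_mem_posSet (he_conj m) (Φ m.succ) s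
  have hcard : ∀ m : Fin r, (P m).card = 3 := fun m => (card_posSet (he_sign m) (Φ m.succ)).trans (h33 m)
  have hmemP : ∀ (m : Fin r) (a : Fin 6), a ∈ P m ↔ (e m).symm (a, true) ∈ (Φ m.succ).1 := fun m a => by
    simp only [P, Finset.mem_filter, Finset.mem_univ, true_and]
  have hsymm_sign : ∀ (m : Fin r) (a : Fin 6), ((e m).symm (a, true)).comp (im m) = τ := fun m a => (he_sign m _).1 (by simp)
  -- (3) the realised tuples are DIAGONAL on every unit
  have hn : ∀ m m' : Fin r, U m' = U m → (6 : ℕ) = 6 := fun _ _ _ => rfl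
  have hdg0 : ∀ π ∈ realisedTuples e τ, ∀ (m m' : Fin r), U m' = U m → ∀ a : Fin 6, π m' a = π m a := by
    intro π hπ m m' h a; obtain ⟨ρ, -, hρ⟩ := (mem_realisedTuples e τ π).1 hπ
    exact diagT _ _ ((hU m m').1 h) (hdeg' m') (hdeg' m) (ρ : ℂ →+* ℂ) a (π m' a) (π m a) (hρ m' a) (hρ m a)
  have hdg : ∀ π ∈ realisedTuples e τ, ∀ (m m' : Fin r) (h : U m' = U m) (a : Fin 6), Fin.cast (hn m m' h) (π m' a) = π m (Fin.cast (hn m m' h) a) := by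
    intro π hπ m m' h a
    have e1 : Fin.cast (hn m m' h) (π m' a) = π m' a := Fin.ext rfl
    have e2 : Fin.cast (hn m m' h) a = a := Fin.ext rfl
    rw [e1, e2]; exact hdg0 π hπ m m' h a
  -- (4) `2`-transitivity on every slot (degree `60`), and stabiliser-transitivity across fields
  have h2t : ∀ (m : Fin r) (a b a' b' : Fin 6), a ≠ b → a' ≠ b' → ∃ π ∈ realisedTuples e τ, π m a = a' ∧ π m b = b' := fun m => by
    obtain ⟨s₀, t₀, hs₀, ht₀, hst₀, hd60⟩ := h60 m
    exact twoTransitive_realisedTuples_of_aut (e := e) he_sign m (twoTransitive_aut_of_finrank_pair h2 im m (nm := 6) (hdeg' m) hs₀ ht₀ hst₀ (by rw [hd60]))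
  have hstab : ∀ (m₀ m : Fin r), U m₀ ≠ U m → ∀ a a' : Fin 6, ∃ ν ∈ realisedTuples e τ, (∀ m', U m' = U m₀ → ν m' = 1) ∧ ν m a = a' := by
    intro m₀ m hne a a'
    have hne' : is m ≠ is m₀ := fun h => hne ((hU m m₀).2 h.symm)
    obtain ⟨ν, hν, hν0, hνa⟩ := stabTransitive_realisedTuples_of_outside_twoTransitive (e := e) he_sign m₀ m (h2t m) (hout m₀ m hne') a a'
    refine ⟨ν, hν, fun m' hm' => Equiv.ext fun b => ?_, hνa⟩
    have hb := hdg0 ν hν m₀ m' hm' b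
    rw [hν0] at hb
    exact hb
  -- (5) the single-slot menu: `3`-HOMOGENEITY of the realised tuples on every slot, from `h3T`
  have hhomR : ∀ (m : Fin r) (Q : Finset (Fin 6)), Q.card = 3 → ∃ π ∈ realisedTuples e τ, preG (π m) (P m) = Q := by
    intro m Q hQ
    have hinj : Function.Injective fun a : Fin 6 => (e m).symm (a, true) := fun a b h => congrArg Prod.fst ((e m).symm.injective h)
    obtain ⟨ρ, hρτ, hρS⟩ := h3T m (Q.image fun a : Fin 6 => (e m).symm (a, true)) ((P m).image fun a : Fin 6 => (e m).symm (a, true))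
      (fun s hs => by obtain ⟨a, -, rfl⟩ := Finset.mem_image.1 hs; exact hsymm_sign m a)
      (fun s hs => by obtain ⟨a, -, rfl⟩ := Finset.mem_image.1 hs; exact hsymm_sign m a)
      (by rw [Finset.card_image_of_injective _ hinj, hQ]) (by rw [Finset.card_image_of_injective _ hinj, hcard m])
    obtain ⟨π, hπ, hπρ⟩ := exists_mem_realisedTuples_of_comp_tau_eq (e := e) he_sign ρ hρτ
    have hinto : ∀ a ∈ Q, π m a ∈ P m := fun a ha => by
      have h1 : (ρ : ℂ →+* ℂ).comp ((e m).symm (a, true)) ∈ (P m).image fun b : Fin 6 => (e m).symm (b, true) := hρS _ (Finset.mem_image.2 ⟨a, ha, rfl⟩)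
      rw [hπρ m a] at h1
      obtain ⟨b, hb, hbe⟩ := Finset.mem_image.1 h1
      have hba : b = π m a := hinj hbe
      rw [← hba]; exact hb
    refine ⟨π, hπ, (Finset.eq_of_subset_of_card_le (fun a ha => mem_preG.2 (hinto a ha)) ?_).symm⟩
    rw [card_preG, hcard m, hQ]
  have hkind : ∀ m : Fin r, (∀ m', U m' = U m → m' = m) → (6 : ℕ).Prime ∨ (3 : ℕ) = 1 ∨
      ∀ Q : Finset (Fin 6), Q.card = 3 → ∃ π ∈ realisedTuples e τ, preG (π m) (P m) = Q := fun m _ => Or.inr (Or.inr (hhomR m))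
  -- (6) transport of the partner structure of a unit to the slot's own field; position sets neither equal nor complementary by non-isogeny (Shimura)
  have castT : ∀ i j : I, i = j → ∀ (Ψ : CMType (Kf i)) (B : AbelianVariety ℂ) (ιB : 𝓞 (Kf i) →+* End B)
      (θB : Kf i →+* Module.End ℂ (complexBetti B.X 1)), IsCMTypeRealisation Ψ B ιB θB →
      ∀ (hi : Module.finrank ℚ (Kf i) = 2 * 6) (hj : Module.finrank ℚ (Kf j) = 2 * 6) (Q : Finset (Fin 6)),
      (∀ s, s ∈ Ψ.1 ↔ (E i hi s).2 = decide ((E i hi s).1 ∈ Q)) →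
      ∃ (Ψ₂ : CMType (Kf j)) (ι₂ : 𝓞 (Kf j) →+* End B) (θ₂ : Kf j →+* Module.End ℂ (complexBetti B.X 1)), IsCMTypeRealisation Ψ₂ B ι₂ θ₂ ∧
        ∀ s, s ∈ Ψ₂.1 ↔ (E j hj s).2 = decide ((E j hj s).1 ∈ Q) := by
    intro i j h; subst h; intro Ψ B ιB θB hB hi hj Q hr; exact ⟨Ψ, ιB, θB, hB, hr⟩
  have hdist : ∀ m m' : Fin r, m' ≠ m → is m' = is m → P m' ≠ P m ∧ P m' ≠ (P m)ᶜ := by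
    intro m m' hne h
    obtain ⟨Ψ₂, ι₂, θ₂, hA₂, hr₂⟩ := castT (is m') (is m) h (Φ m'.succ) (A m'.succ) (ι m'.succ) (θ m'.succ) (hA m'.succ) (hdeg' m') (hdeg' m) (P m') (hΦ m')
    have hsh := DihedralSexticPair.cmType_ne_and_ne_compl_of_not_isIsogenous (hA m.succ) hA₂ (hni m m' hne h)
    refine ⟨fun heq => hsh.1 (Set.ext fun s => (hΦ m s).trans (by rw [← heq]; exact (hr₂ s).symm)), fun hq => hsh.2 (Set.ext fun s => ?_)⟩
    have hX : ((e m s).2 = decide ((e m s).1 ∈ P m')) ↔ ¬ ((e m s).2 = decide ((e m s).1 ∈ P m)) :=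
      eq_decide_iff_not_eq_decide (by rw [hq, Finset.mem_compl])
    exact (hr₂ s).trans ((hX.trans (not_congr (hΦ m s)).symm).trans (Set.mem_compl_iff _ _).symm)
  -- THE SEPARATION PROPERTY OF A UNIT WITH TWO SLOTS: U1 over the `2`-transitive image (two `3`-sets neither equal nor complementary are `ℚ`-independent)
  have hcardU : ∀ m, Fintype.card {m' : Fin r // U m' = U m} = (Finset.univ.filter fun m' : Fin r => is m' = is m).card := fun m => by
    rw [Fintype.card_subtype]; exact congrArg Finset.card (Finset.ext fun x => by simp only [Finset.mem_filter, Finset.mem_univ, true_and, hU])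
  have hunit : ∀ m, (∃ m', m' ≠ m ∧ U m' = U m) → ∀ (u : {m' : Fin r // U m' = U m} → Fin 6 → ℤ) (w : ℤ),
      (∀ π ∈ realisedTuples e τ, (∑ i, ∑ x : Fin 6, (if π m x ∈ (P i.1).image (Fin.cast (hn m i.1 i.2)) then u i x else -u i x)) = w) →
      ∀ (i : {m' : Fin r // U m' = U m}) (a b : Fin 6), u i a = u i b := by
    intro m hm u w hw
    obtain ⟨m', hm'm, hUm'⟩ := hm
    have him : is m' = is m := (hU m m').1 hUm'
    have hix : ∀ x : {x : Fin r // U x = U m}, is x.1 = is m := fun x => (hU m x.1).1 x.2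
    have hQcard : ∀ i : {m' : Fin r // U m' = U m}, ((P i.1).image (Fin.cast (hn m i.1 i.2))).card = 3 := fun i => by
      rw [Finset.card_image_of_injective _ (Fin.cast_injective _), hcard]
    have hmemF : ∀ x : {x : Fin r // U x = U m}, x.1 ∈ Finset.univ.filter fun y : Fin r => is y = is m := fun x => by
      simp only [Finset.mem_filter, Finset.mem_univ, true_and]; exact hix x
    have huniv : ∀ x : {x : Fin r // U x = U m}, x = ⟨m, rfl⟩ ∨ x = ⟨m', hUm'⟩ := by
      intro x
      have hF : ({m, m'} : Finset (Fin r)) = Finset.univ.filter fun y : Fin r => is y = is m :=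
        Finset.eq_of_subset_of_card_le (fun y hy => by
            simp only [Finset.mem_insert, Finset.mem_singleton] at hy; simp only [Finset.mem_filter, Finset.mem_univ, true_and]
            rcases hy with rfl | rfl; exacts [rfl, him])
          (by rw [Finset.card_pair hm'm.symm]; exact hfib m)
      have hx := hmemF x
      rw [← hF, Finset.mem_insert, Finset.mem_singleton] at hx
      rcases hx with h | h
      exacts [Or.inl (Subtype.ext h), Or.inr (Subtype.ext h)]
    have hQeq : ∀ x : {x : Fin r // U x = U m}, (P x.1).image (Fin.cast (hn m x.1 x.2)) = P x.1 := fun x => image_cast_self _ _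
    have hd := hdist m m' hm'm him
    have hli0 : LinearIndependent ℚ fun x : {x : Fin r // U x = U m} => fun q : Fin 6 =>
        ((6 : ℚ) * (if q ∈ (P x.1).image (Fin.cast (hn m x.1 x.2)) then 1 else 0) - ((P x.1).image (Fin.cast (hn m x.1 x.2))).card) := by
      refine linearIndependent_cells_of_two (k := 6) ⟨m, rfl⟩ ⟨m', hUm'⟩ (fun h => hm'm.symm (congrArg Subtype.val h)) huniv
        (fun x => (P x.1).image (Fin.cast (hn m x.1 x.2))) (fun x => Finset.card_pos.1 (by rw [hQcard]; norm_num))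
        (fun x => by rw [hQcard]; norm_num) ?_ ?_
      · rw [hQeq, hQeq]; exact hd.1
      · rw [hQeq, hQeq]; exact hd.2
    have hli : LinearIndependent ℚ fun x : {x : Fin r // U x = U m} => fun q : Fin 6 =>
        ((6 : ℚ) * (if q ∈ (P x.1).image (Fin.cast (hn m x.1 x.2)) then 1 else 0) - (P x.1).card) := by
      have hfun : (fun x : {x : Fin r // U x = U m} => fun q : Fin 6 =>
          ((6 : ℚ) * (if q ∈ (P x.1).image (Fin.cast (hn m x.1 x.2)) then 1 else 0) - (P x.1).card)) =
          fun x : {x : Fin r // U x = U m} => fun q : Fin 6 =>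
            ((6 : ℚ) * (if q ∈ (P x.1).image (Fin.cast (hn m x.1 x.2)) then 1 else 0) - ((P x.1).image (Fin.cast (hn m x.1 x.2))).card) := by
        funext x q; rw [Finset.card_image_of_injective _ (Fin.cast_injective _)]
      rw [hfun]; exact hli0
    exact unit_separated_of_twoTransitive (R := realisedTuples e τ) (P := P) (fun _ hπ _ hπ' => mul_mem_realisedTuples e τ hπ hπ') U hn m
      (fun a a' b b' haa hbb => h2t m a a' b b' haa hbb) (by exact_mod_cast hli) u w hw
  -- (7) the engine with separated units; the single-slot Weil spaces from Markman's sixfold theorem and the hyperbolicity data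
  exact hodgeConjectureFor_biproduct_comp_of_unitsSeparated_frames (is := is) (n := fun _ => 6) P (fun _ => 3) hcard (fun _ => by norm_num) (fun _ => by norm_num)
    κ h2 im hτ hA e he_sign he_conj hΨ hΦ U hn hdg hstab hunit hkind
    fun m => by
      obtain ⟨eP, a, ha, ha0, hh⟩ := hhyp m
      exact weilHyp_of_markman_sixfold_hyperbolic hM6 m (hdeg m) hd hδ hA eP ha ha0 hh

/-- **Dominated form.** [cite: Markman2025SecantWeil, Thm 1.5.1] [cite: MumfordAV1970, §19 Thm. 1 and p. 169] -/
theorem hodgeConjectureFor_of_avDominatedBy_comp_of_dodecicHyperbolicPairs (hM6 : Markman2025_weilClasses_algebraic_hyperbolicSixfold)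
    {N : ℕ} (κ : Fin N → Fin (r + 1)) (h2 : Module.finrank ℚ (Kf i₀) = 2)
    (hdeg : ∀ m : Fin r, Module.finrank ℚ (Kf (is m)) = 12) (iK : ∀ i : I, Kf i₀ →+* Kf i)
    (hA : ∀ j, IsCMTypeRealisation (Φ j) (A j) (ι j) (θ j)) (hΨ : ∀ σ : Kf i₀ →+* ℂ, σ ∈ (Φ 0).1 ↔ σ = τ)
    (δ : 𝓞 (Kf i₀)) (d : ℕ) (hd : 0 < d) (hδ : ((δ : Kf i₀)) ^ 2 = -(d : Kf i₀)) (hτ : τ (δ : Kf i₀) = Complex.I * (Real.sqrt d : ℂ))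
    (h33 : ∀ m : Fin r, (Finset.univ.filter fun s : Kf (is m) →+* ℂ => s.comp (iK (is m)) = τ ∧ s ∈ (Φ m.succ).1).card = 3)
    (hfib : ∀ m : Fin r, (Finset.univ.filter fun m' : Fin r => is m' = is m).card ≤ 2)
    (hni : ∀ m m' : Fin r, m' ≠ m → is m' = is m → ¬ AbelianVariety.IsIsogenous (A m.succ) (A m'.succ))
    (h60 : ∀ m : Fin r, ∃ s₀ t₀ : Kf (is m) →+* ℂ, s₀.comp (iK (is m)) = τ ∧ t₀.comp (iK (is m)) = τ ∧ s₀ ≠ t₀ ∧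
      Module.finrank ℚ ↥(adjoin ℚ (Set.range τ) ⊔ adjoin ℚ (Set.range s₀ ∪ Set.range t₀)) = 60)
    (h3T : ∀ (m : Fin r) (S S' : Finset (Kf (is m) →+* ℂ)), (∀ s ∈ S, s.comp (iK (is m)) = τ) → (∀ s ∈ S', s.comp (iK (is m)) = τ) → S.card = 3 → S'.card = 3 →
      ∃ ρ : ℂ ≃+* ℂ, (ρ : ℂ →+* ℂ).comp τ = τ ∧ ∀ s ∈ S, (ρ : ℂ →+* ℂ).comp s ∈ S')
    (hout : ∀ m₀ m : Fin r, is m ≠ is m₀ → ∃ s : Kf (is m) →+* ℂ, s.comp (iK (is m)) = τ ∧ ∃ x, s x ∉ normalClosure ℚ (Kf (is m₀)) ℂ)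
    (hhyp : ∀ m : Fin r, ∃ (eP : ProjectiveEmbedding (⨁ fun j : Fin 1 => A (partSlots 0 m j)).X) (a : complexBetti (projectiveSpace eP.n ℂ) 2),
      IsRationalClass a ∧ a ≠ 0 ∧ IsHyperbolicWeilType (⨁ fun j : Fin 1 => A (partSlots 0 m j))
        (biproduct.map fun j : Fin 1 => ι (partSlots 0 m j) (δfam (fun m => iK (is m)) δ (partSlots 0 m j))) 3
        ((d : ℂ) • complexBetti.map eP.ι 2 a +
          complexBetti.map (biproduct.map fun j : Fin 1 => ι (partSlots 0 m j) (δfam (fun m => iK (is m)) δ (partSlots 0 m j))).hom.hom.hom 2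
            (complexBetti.map eP.ι 2 a)))
    {X : AbelianVariety ℂ} (hX : Domination.AVDominatedBy X (⨁ fun j => A (κ j))) : HodgeConjectureFor X.dim X.X :=
  Domination.hodgeConjectureFor_of_avDominatedBy
    (hodgeConjectureFor_biproduct_comp_of_dodecicHyperbolicPairs hM6 κ h2 hdeg iK hA hΨ δ d hd hδ hτ h33 hfib hni h60 h3T hout hhyp) hX

end DodecicPairs

end Summit.HodgeConjecture.CorCM.MultiFieldWeil

end
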